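import Summits.BirchSwinnertonDyer.BirchSwinnertonDyer.Theses.KolyvaginDepthDoor
import HarnessLib

/-!
# Route `KolyvaginDepthDoor`, crux `KolyvaginDepthSupply` (stmt-BirchSwinnertonDyer-21765) —
# the PER-CURVE DOOR THEOREM and the rank-2 slice, modulo Kolyvagin's structure theorem

Helper file (`--supports stmt-BirchSwinnertonDyer-21765 --as helper`); it closes nothing. Every
theorem here is CONDITIONAL on exactly one named literature fact, the route's support item
`KolyvaginStructure` = `Literature.NumberTheory.EllipticCurves.Kolyvagin1991_selmerCorank_of_kolyvaginClass_ne_zero`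
(Kolyvagin 1991, Thm. 4 = W. Zhang 2014, Thm. 11.2 (i); size XL, no `_holds`), written `hF`
below; everything else is proved in the tree (the Kummer identity
`corank_{ℤ_p} Sel_{p^∞}(E/ℚ) = rank E(ℚ) + corank_{ℤ_p} Ш(E/ℚ)[p^∞]`,
`WeierstrassCurve.selmerCorank_eq_mordellWeilRank_add_holds`, Greenberg LNM 1716 §1).

Notation: `E/ℚ` globally minimal (`W`), `p ≥ 5` with `ρ̄_{E,p}` onto, `K` imaginary quadratic with
the Heegner hypothesis for `N_E`, `d_K ∉ {−3, −4}`, `p ∤ d_K N_E`; `c_M(n)` =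
`KolyvaginHeegnerData.kolyvaginClass` the Kolyvagin–Heegner class of a square-free product `n` of
Kolyvagin primes (`KolyvaginDescent.KolSupp (Zhang2014.IsKolyvaginPrime N_E W K p) n`) at a level
`1 ≤ M ≤ M(n)` (`Zhang2014.levelIndex`); `ν(n) = #{ℓ ∣ n}` its DEPTH; `r = rank E(ℚ)`,
`r' = rank E^{(d_K)}(ℚ)`, `c = corank Sel_{p^∞}(E/ℚ)`, `c' = corank Sel_{p^∞}(E^{(d_K)}/ℚ)`,
`t_p = corank Ш(E/ℚ)[p^∞] = c − r`.

## What is proved (the critic's price for this line: "a per-curve DOOR + instrument — the first typed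
## anticyclotomic certificate of corank Ш[p^∞] = 0"; REQUESTS.md 2026-08-27T20:35:18Z)

* `exists_minimal_kolyvaginClass_ne_zero` — bookkeeping: from ONE non-zero class `c_M(n) ≠ 0` of
  the system attached to `(Dt, β, ι)`, a non-zero class of MINIMAL depth `ν₀ ≤ ν(n)` exists
  (`Nat.find`), and `hF` there gives Kolyvagin's dichotomy
  `{c, c'} = {ν₀ + 1, s}` with `s ≤ ν₀`, `ν₀ − s` even.
* `shaCorank_eq_zero_of_kolyvaginClass_ne_zero_of_depth_lt_rank` — **THE DOOR.** If `c_M(n) ≠ 0`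
  and `ν(n) + 1 ≤ r` ("a non-zero class at depth below the number of known independent points"),
  then `t_p(E) = 0`, `c = r = ν(n) + 1`, `c' ≤ r − 1` and `r − 1 − c'` is even. NO minimality
  hypothesis and NO condition on the twist are needed: by Kummer `c ≥ r ≥ ν(n) + 1 ≥ ν₀ + 1`, so the
  dichotomy at the minimiser can only be `c = ν₀ + 1`, whence `c = r` (`omega`). This is the
  route's reading "points first, Ш after" as a stand-alone certificate: a COMPUTED non-zero derived
  class at depth `r − 1` certifies `corank_{ℤ_p} Ш(E)[p^∞] = 0` with no `p`-adic `L`-function, main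
  conjecture or `p`-adic height (modulo Kolyvagin 1991 Thm. 4 only).
* `shaCorank_eq_zero_of_kolyvaginClass_ne_zero_of_depth_lt_twist_rank` — the twist-side door:
  `c_M(n) ≠ 0`, `ν(n) ≤ r`, `ν(n) + 1 ≤ r'` force `t_p(E) = 0` AND `t_p(E^{(d_K)}) = 0`, `c = r = ν(n)`,
  `c' = r' = r + 1`.
* `shaCorank_eq_zero_of_rank_two_of_kolyvaginClass_prime_ne_zero` — **THE RANK-2 SLICE** (the
  DEPTH-TABLE ROW CERTIFICATE of the route's cheapest falsifier / instrument): `rank E(ℚ) = 2`, ONE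
  Kolyvagin prime `ℓ`, a level `1 ≤ M ≤ M(ℓ)` and `c_M(ℓ) ≠ 0` give `t_p(E) = 0`, `c = 2` and
  `c' = 1` (the last by Kolyvagin's parity clause). A depth-table row `(E, p, K, ℓ, M)` with
  `c_M(ℓ) ≠ 0` (Jetchev–Lauter–Stein algorithm, arXiv:0707.0032 §3.6) is, modulo `hF`, a certificate
  of `corank Ш(E)[p^∞] = 0` for a rank-2 curve — nothing about the twist or about depth-0 classes
  has to be checked.
* `kolyvaginDepthSupply_iff_weak` — modulo `hF` the crux `KolyvaginDepthSupply` is EQUIVALENT to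
  its weak form (same data, but NO minimality conjunct and the rank clause relaxed to
  `ν(n) + 1 ≤ r ∨ (ν(n) ≤ r ∧ ν(n) + 1 ≤ r')`, written out literally — no `def` is minted): the
  minimality conjunct `∀ n' d' M', … → ν(n) ≤ ν(n')` and the exact equations of the crux are idle for
  the kernel of `closes` and are RECOVERED from `hF` at the minimiser. For the planner: the weak
  form is what a depth table instantiates row by row.
* `shaCorank_eq_zero_nonCM_of_weakDepthSupply` — the kernel of the route's deciding theorem run
  from the weak form: weak supply + `hF` ⇒ X1 on non-CM curves (`∃ p ≥ 5` good ordinary with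
  `t_p = 0`), i.e. exactly the `hX1` of `closes` restricted to `¬ HasCM`.

Honesty. Class-wide the open content of the crux is X1 on non-CM curves (t_p = 0 at one surjective
good ordinary prime for every non-CM `E` of rank ≥ 2; critic verdict, KatoTransfer-X1-hard); this
file does not move it and BSD is not proved by any of this. The theorems are per-curve doors: they
turn ONE non-vanishing `c_M(n) ≠ 0` into `t_p = 0`, conditionally on Kolyvagin 1991 Thm. 4.

References: [Kolyvagin1991MathAnn] V. A. Kolyvagin, *On the structure of Selmer groups*, Math. Ann.
291 (1991) 253–259, §2 Thm. 4; [WZhang2014] W. Zhang, *Selmer groups and the indivisibility of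
Heegner points*, Camb. J. Math. 2 (2014), Thm. 1.2, Thm. 11.2 (i); [GreenbergLNM1716] R. Greenberg,
LNM 1716 (1999), §1 pp. 54–57; [JetchevLauterStein2009] D. Jetchev, K. Lauter, W. Stein, *Explicit
Heegner points: Kolyvagin's conjecture and non-trivial elements in the Shafarevich–Tate group*,
J. Number Theory 129 (2009) = arXiv:0707.0032, §3.6 and Prop. 3.10.
-/

-- D-0017: single-problem summit, `Summit.BirchSwinnertonDyer.BirchSwinnertonDyer.…` repeats a
-- namespace component by design.
set_option linter.dupNamespace false

noncomputable section

open scoped Classical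

namespace Summit.BirchSwinnertonDyer.BirchSwinnertonDyer.Theorems.KolyvaginDepthDoor

open Literature.NumberTheory.EllipticCurves Literature.NumberTheory.EllipticCurves.ModularForms
  WeierstrassCurve
open Summit.BirchSwinnertonDyer.BirchSwinnertonDyer.Theses.KolyvaginDepthDoor

/-! ## The minimiser and Kolyvagin's dichotomy there -/

/-- **Bookkeeping: order of vanishing and the dichotomy at it.** Modulo Kolyvagin 1991 Thm. 4
(`hF`): in the setting of that fact, if ONE class `c_M(n)` of the Kolyvagin–Heegner system attached
to `(Dt, β, ι)` is non-zero, then there is a non-zero class `c_{M₀}(n₀)` of minimal depth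
`ν(n₀) ≤ ν(n)` among all non-zero classes of the system (`Nat.find`), and at it one of
`c = corank Sel_{p^∞}(E/ℚ)`, `c' = corank Sel_{p^∞}(E^{(d_K)}/ℚ)` equals `ν(n₀) + 1` while the
other is `≤ ν(n₀)` with even defect. Adapted from the minimisation step of
`Theorems.stub_kolyvagin_structure_of_facts` (line `heegner_order` of crux `SelmerRankLB`).
CONDITIONAL on `hF`. [cite: Kolyvagin1991MathAnn, §2 Thm. 4]
[cite: WZhang2014, Thm. 11.2 (i) (p. 248)] -/
theorem exists_minimal_kolyvaginClass_ne_zero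
    (hF : Kolyvagin1991_selmerCorank_of_kolyvaginClass_ne_zero)
    (W : WeierstrassCurve ℚ) [W.IsElliptic] [W.IsGloballyMinimal] (p : ℕ) [hp : Fact p.Prime]
    (h5 : 5 ≤ p) (hsurj : W.HasSurjectiveModNGaloisRep p)
    (K : Type) [Field K] [NumberField K] (hK : IsImaginaryQuadratic K)
    (h3 : NumberField.discr K ≠ -3) (h4 : NumberField.discr K ≠ -4)
    (hpd : ¬ ((p : ℤ) ∣ NumberField.discr K)) (hpN : ¬ (p ∣ W.conductorNorm ℤ))
    [NeZero (W.conductorNorm ℤ)] (hH : SatisfiesHeegnerHypothesis (W.conductorNorm ℤ) K)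
    (Dt : ModularParametrizationData W (W.conductorNorm ℤ)) (β : ℤ) (ι : K →+* ℂ) (n : ℕ)
    (d : KolyvaginHeegnerData Dt β ι n) (M : ℕ)
    (hΛ : KolyvaginDescent.KolSupp (Zhang2014.IsKolyvaginPrime (W.conductorNorm ℤ) W K p) n)
    (hM : 1 ≤ M) (hMle : (M : ℕ∞) ≤ Zhang2014.levelIndex W p n)
    (hne : d.kolyvaginClass hp.out M ≠ 0) :
    ∃ (n₀ : ℕ) (d₀ : KolyvaginHeegnerData Dt β ι n₀) (M₀ : ℕ),
      KolyvaginDescent.KolSupp (Zhang2014.IsKolyvaginPrime (W.conductorNorm ℤ) W K p) n₀ ∧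
      1 ≤ M₀ ∧ (M₀ : ℕ∞) ≤ Zhang2014.levelIndex W p n₀ ∧ d₀.kolyvaginClass hp.out M₀ ≠ 0 ∧
      n₀.primeFactors.card ≤ n.primeFactors.card ∧
      (∀ (n' : ℕ) (d' : KolyvaginHeegnerData Dt β ι n') (M' : ℕ),
        KolyvaginDescent.KolSupp (Zhang2014.IsKolyvaginPrime (W.conductorNorm ℤ) W K p) n' →
        1 ≤ M' → (M' : ℕ∞) ≤ Zhang2014.levelIndex W p n' → d'.kolyvaginClass hp.out M' ≠ 0 →
        n₀.primeFactors.card ≤ n'.primeFactors.card) ∧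
      ((W.selmerCorank p = n₀.primeFactors.card + 1 ∧
          (W.quadraticTwist (NumberField.discr K : ℚ)).selmerCorank p ≤ n₀.primeFactors.card ∧
          Even (n₀.primeFactors.card -
            (W.quadraticTwist (NumberField.discr K : ℚ)).selmerCorank p)) ∨
        ((W.quadraticTwist (NumberField.discr K : ℚ)).selmerCorank p = n₀.primeFactors.card + 1 ∧
          W.selmerCorank p ≤ n₀.primeFactors.card ∧
          Even (n₀.primeFactors.card - W.selmerCorank p))) := by
  -- the order of vanishing: minimise `ν(n')` over the non-zero classes of this system
  have hex : ∃ k, ∃ (n' : ℕ) (d' : KolyvaginHeegnerData Dt β ι n') (M' : ℕ),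
      KolyvaginDescent.KolSupp (Zhang2014.IsKolyvaginPrime (W.conductorNorm ℤ) W K p) n' ∧
        1 ≤ M' ∧ (M' : ℕ∞) ≤ Zhang2014.levelIndex W p n' ∧ d'.kolyvaginClass hp.out M' ≠ 0 ∧
        n'.primeFactors.card = k :=
    ⟨_, n, d, M, hΛ, hM, hMle, hne, rfl⟩
  obtain ⟨n₀, d₀, M₀, hΛ₀, hM₀, hM₀le, hne₀, hcard⟩ := Nat.find_spec hex
  have hmin : ∀ (n' : ℕ) (d' : KolyvaginHeegnerData Dt β ι n') (M' : ℕ),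
      KolyvaginDescent.KolSupp (Zhang2014.IsKolyvaginPrime (W.conductorNorm ℤ) W K p) n' →
      1 ≤ M' → (M' : ℕ∞) ≤ Zhang2014.levelIndex W p n' → d'.kolyvaginClass hp.out M' ≠ 0 →
      n₀.primeFactors.card ≤ n'.primeFactors.card := by
    intro n' d' M' hΛ' hM' hM'le hne'
    rw [hcard]
    exact Nat.find_min' hex ⟨n', d', M', hΛ', hM', hM'le, hne', rfl⟩
  -- Kolyvagin's structure theorem at the minimiser
  have hstruct := hF W p h5 hsurj K hK h3 h4 hpd hpN hH Dt β ι n₀ d₀ M₀ hΛ₀ hM₀ hM₀le hne₀ hmin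
  exact ⟨n₀, d₀, M₀, hΛ₀, hM₀, hM₀le, hne₀, hmin n d M hΛ hM hMle hne, hmin, hstruct⟩

/-! ## The door: a non-zero class below the rank certifies `corank Ш(E)[p^∞] = 0` -/

/-- **The per-curve door theorem (modulo Kolyvagin 1991, Thm. 4).** Let `E/ℚ` be globally minimal,
`p ≥ 5` with `ρ̄_{E,p}` surjective, `K` imaginary quadratic with the Heegner hypothesis for `N_E`,
`d_K ∉ {−3, −4}`, `p ∤ d_K N_E`. If some Kolyvagin–Heegner class `c_M(n) ≠ 0` (square-free product
`n` of Kolyvagin primes, `1 ≤ M ≤ M(n)`) has depth `ν(n) = #{ℓ ∣ n}` with `ν(n) + 1 ≤ rank E(ℚ)`,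
then `corank_{ℤ_p} Ш(E/ℚ)[p^∞] = 0`, `corank Sel_{p^∞}(E/ℚ) = rank E(ℚ) = ν(n) + 1`,
`corank Sel_{p^∞}(E^{(d_K)}/ℚ) ≤ rank E(ℚ) − 1` with even defect. No minimality of `ν(n)` and no
condition on the twist is assumed: with `ν₀ ≤ ν(n)` the minimal depth of a non-zero class,
Kolyvagin's dichotomy gives `max(c, c') = ν₀ + 1 ≤ rank E(ℚ) ≤ c` (Kummer), so `c = ν₀ + 1 = rank`
and `t_p = c − rank = 0`. "Points first, Ш after": a COMPUTED non-zero derived class at depth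
`rank − 1` certifies the cotorsion-freeness of `Ш(E)[p^∞]`. CONDITIONAL on `hF`; per-curve, not a
class theorem; BSD is not proved by it. [cite: Kolyvagin1991MathAnn, §2 Thm. 4]
[cite: WZhang2014, Thm. 1.2 (p. 195) and Thm. 11.2 (i) (p. 248)]
[cite: GreenbergLNM1716, §1 pp. 54–57] -/
theorem shaCorank_eq_zero_of_kolyvaginClass_ne_zero_of_depth_lt_rank
    (hF : Kolyvagin1991_selmerCorank_of_kolyvaginClass_ne_zero)
    (W : WeierstrassCurve ℚ) [W.IsElliptic] [W.IsGloballyMinimal] (p : ℕ) [hp : Fact p.Prime]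
    (h5 : 5 ≤ p) (hsurj : W.HasSurjectiveModNGaloisRep p)
    (K : Type) [Field K] [NumberField K] (hK : IsImaginaryQuadratic K)
    (h3 : NumberField.discr K ≠ -3) (h4 : NumberField.discr K ≠ -4)
    (hpd : ¬ ((p : ℤ) ∣ NumberField.discr K)) (hpN : ¬ (p ∣ W.conductorNorm ℤ))
    [NeZero (W.conductorNorm ℤ)] (hH : SatisfiesHeegnerHypothesis (W.conductorNorm ℤ) K)
    (Dt : ModularParametrizationData W (W.conductorNorm ℤ)) (β : ℤ) (ι : K →+* ℂ) (n : ℕ)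
    (d : KolyvaginHeegnerData Dt β ι n) (M : ℕ)
    (hΛ : KolyvaginDescent.KolSupp (Zhang2014.IsKolyvaginPrime (W.conductorNorm ℤ) W K p) n)
    (hM : 1 ≤ M) (hMle : (M : ℕ∞) ≤ Zhang2014.levelIndex W p n)
    (hne : d.kolyvaginClass hp.out M ≠ 0)
    (hdepth : n.primeFactors.card + 1 ≤ W.mordellWeilRank) :
    W.shaCorank p = 0 ∧ W.selmerCorank p = W.mordellWeilRank ∧
      n.primeFactors.card + 1 = W.mordellWeilRank ∧
      (W.quadraticTwist (NumberField.discr K : ℚ)).selmerCorank p + 1 ≤ W.mordellWeilRank ∧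
      Even (W.mordellWeilRank - 1 - (W.quadraticTwist (NumberField.discr K : ℚ)).selmerCorank p) := by
  obtain ⟨n₀, d₀, M₀, -, -, -, -, hle, -, hstruct⟩ :=
    exists_minimal_kolyvaginClass_ne_zero hF W p h5 hsurj K hK h3 h4 hpd hpN hH Dt β ι n d M hΛ hM
      hMle hne
  -- Kummer: `c = r + t_p ≥ r`
  have hid : W.selmerCorank p = W.mordellWeilRank + W.shaCorank p :=
    W.selmerCorank_eq_mordellWeilRank_add_holds p
  rcases hstruct with ⟨hc, hc', hev⟩ | ⟨-, hc, -⟩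
  · refine ⟨by omega, by omega, by omega, by omega, ?_⟩
    have h0 : n₀.primeFactors.card = W.mordellWeilRank - 1 := by omega
    rw [← h0]
    exact hev
  · exfalso
    omega

/-- **The twist-side door (modulo Kolyvagin 1991, Thm. 4).** Same setting; if `c_M(n) ≠ 0` with
`ν(n) ≤ rank E(ℚ)` and `ν(n) + 1 ≤ rank E^{(d_K)}(ℚ)`, then BOTH `corank Ш(E/ℚ)[p^∞] = 0` and
`corank Ш(E^{(d_K)}/ℚ)[p^∞] = 0`, with `corank Sel_{p^∞}(E/ℚ) = rank E(ℚ) = ν(n)` and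
`corank Sel_{p^∞}(E^{(d_K)}/ℚ) = rank E^{(d_K)}(ℚ) = rank E(ℚ) + 1`: Kummer on both curves pins the
dichotomy at the minimiser to `c' = ν₀ + 1`, `c ≤ ν₀ ≤ ν(n) ≤ rank E(ℚ) ≤ c`. (This is the second
rank clause of the crux, again with inequalities in place of its equations and without minimality.)
CONDITIONAL on `hF`. [cite: Kolyvagin1991MathAnn, §2 Thm. 4]
[cite: WZhang2014, Thm. 11.2 (i) (p. 248)] [cite: GreenbergLNM1716, §1 pp. 54–57] -/
theorem shaCorank_eq_zero_of_kolyvaginClass_ne_zero_of_depth_lt_twist_rank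
    (hF : Kolyvagin1991_selmerCorank_of_kolyvaginClass_ne_zero)
    (W : WeierstrassCurve ℚ) [W.IsElliptic] [W.IsGloballyMinimal] (p : ℕ) [hp : Fact p.Prime]
    (h5 : 5 ≤ p) (hsurj : W.HasSurjectiveModNGaloisRep p)
    (K : Type) [Field K] [NumberField K] (hK : IsImaginaryQuadratic K)
    (h3 : NumberField.discr K ≠ -3) (h4 : NumberField.discr K ≠ -4)
    (hpd : ¬ ((p : ℤ) ∣ NumberField.discr K)) (hpN : ¬ (p ∣ W.conductorNorm ℤ))
    [NeZero (W.conductorNorm ℤ)] (hH : SatisfiesHeegnerHypothesis (W.conductorNorm ℤ) K)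
    (Dt : ModularParametrizationData W (W.conductorNorm ℤ)) (β : ℤ) (ι : K →+* ℂ) (n : ℕ)
    (d : KolyvaginHeegnerData Dt β ι n) (M : ℕ)
    (hΛ : KolyvaginDescent.KolSupp (Zhang2014.IsKolyvaginPrime (W.conductorNorm ℤ) W K p) n)
    (hM : 1 ≤ M) (hMle : (M : ℕ∞) ≤ Zhang2014.levelIndex W p n)
    (hne : d.kolyvaginClass hp.out M ≠ 0)
    (hdepth : n.primeFactors.card ≤ W.mordellWeilRank)
    (hdepth' : n.primeFactors.card + 1 ≤
      (W.quadraticTwist (NumberField.discr K : ℚ)).mordellWeilRank) :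
    W.shaCorank p = 0 ∧ (W.quadraticTwist (NumberField.discr K : ℚ)).shaCorank p = 0 ∧
      W.selmerCorank p = W.mordellWeilRank ∧ n.primeFactors.card = W.mordellWeilRank ∧
      (W.quadraticTwist (NumberField.discr K : ℚ)).selmerCorank p = W.mordellWeilRank + 1 ∧
      (W.quadraticTwist (NumberField.discr K : ℚ)).mordellWeilRank = W.mordellWeilRank + 1 := by
  obtain ⟨n₀, d₀, M₀, -, -, -, -, hle, -, hstruct⟩ :=
    exists_minimal_kolyvaginClass_ne_zero hF W p h5 hsurj K hK h3 h4 hpd hpN hH Dt β ι n d M hΛ hM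
      hMle hne
  -- Kummer on `E` and on the twist `E^{(d_K)}` (an elliptic curve since `d_K ≠ 0`)
  have hid : W.selmerCorank p = W.mordellWeilRank + W.shaCorank p :=
    W.selmerCorank_eq_mordellWeilRank_add_holds p
  have hdK : (NumberField.discr K : ℚ) ≠ 0 := by exact_mod_cast NumberField.discr_ne_zero K
  haveI := W.isElliptic_quadraticTwist hdK
  have hidT : (W.quadraticTwist (NumberField.discr K : ℚ)).selmerCorank p =
      (W.quadraticTwist (NumberField.discr K : ℚ)).mordellWeilRank +
        (W.quadraticTwist (NumberField.discr K : ℚ)).shaCorank p :=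
    (W.quadraticTwist (NumberField.discr K : ℚ)).selmerCorank_eq_mordellWeilRank_add_holds p
  rcases hstruct with ⟨-, hc', -⟩ | ⟨hc', hc, -⟩
  · exfalso
    omega
  · exact ⟨by omega, by omega, by omega, by omega, by omega, by omega⟩

/-! ## The rank-2 slice: the depth-table row certificate -/

/-- **The rank-2 slice of the door = the depth-table row certificate (modulo Kolyvagin 1991,
Thm. 4).** Let `E/ℚ` be globally minimal of Mordell–Weil rank `2`, `p ≥ 5` with `ρ̄_{E,p}` onto,
`K` imaginary quadratic (Heegner hypothesis for `N_E`, `d_K ∉ {−3, −4}`, `p ∤ d_K N_E`), `ℓ` ONE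
Kolyvagin prime (`Zhang2014.IsKolyvaginPrime`: `ℓ ∤ N_E d_K p` inert in `K` with
`M(ℓ) = min(ord_p(ℓ + 1), ord_p a_ℓ) ≥ 1`), `d` a Kolyvagin–Heegner datum of conductor `ℓ` and
`1 ≤ M ≤ M(ℓ)`. If the first derived class does not vanish, `c_M(ℓ) ≠ 0` — the entry a DEPTH TABLE
computes (Jetchev–Lauter–Stein: `P_ℓ = Σ iσ^i y_ℓ ∉ p^M E(K[ℓ])` via division polynomials over the
ring class field `K[ℓ]`) —, then `corank_{ℤ_p} Ш(E/ℚ)[p^∞] = 0`, `corank Sel_{p^∞}(E/ℚ) = 2` and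
`corank Sel_{p^∞}(E^{(d_K)}/ℚ) = 1` (Kolyvagin's parity clause). Nothing about depth-0 classes or
about the rank of the twist has to be checked. CONDITIONAL on `hF`; a per-curve certificate, not a
class theorem; BSD is not proved by it. [cite: Kolyvagin1991MathAnn, §2 Thm. 4]
[cite: WZhang2014, Thm. 11.2 (i) (p. 248)]
[cite: JetchevLauterStein2009, §3.6 and Prop. 3.10 (arXiv:0707.0032)] -/
theorem shaCorank_eq_zero_of_rank_two_of_kolyvaginClass_prime_ne_zero
    (hF : Kolyvagin1991_selmerCorank_of_kolyvaginClass_ne_zero)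
    (W : WeierstrassCurve ℚ) [W.IsElliptic] [W.IsGloballyMinimal] (hr : W.mordellWeilRank = 2)
    (p : ℕ) [hp : Fact p.Prime] (h5 : 5 ≤ p) (hsurj : W.HasSurjectiveModNGaloisRep p)
    (K : Type) [Field K] [NumberField K] (hK : IsImaginaryQuadratic K)
    (h3 : NumberField.discr K ≠ -3) (h4 : NumberField.discr K ≠ -4)
    (hpd : ¬ ((p : ℤ) ∣ NumberField.discr K)) (hpN : ¬ (p ∣ W.conductorNorm ℤ))
    [NeZero (W.conductorNorm ℤ)] (hH : SatisfiesHeegnerHypothesis (W.conductorNorm ℤ) K)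
    (Dt : ModularParametrizationData W (W.conductorNorm ℤ)) (β : ℤ) (ι : K →+* ℂ)
    (ℓ : ℕ) (hℓ : ℓ.Prime) (hkol : Zhang2014.IsKolyvaginPrime (W.conductorNorm ℤ) W K p ℓ)
    (d : KolyvaginHeegnerData Dt β ι ℓ) (M : ℕ)
    (hM : 1 ≤ M) (hMle : (M : ℕ∞) ≤ Zhang2014.levelIndex W p ℓ)
    (hne : d.kolyvaginClass hp.out M ≠ 0) :
    W.shaCorank p = 0 ∧ W.selmerCorank p = 2 ∧
      (W.quadraticTwist (NumberField.discr K : ℚ)).selmerCorank p = 1 := by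
  have hΛ : KolyvaginDescent.KolSupp (Zhang2014.IsKolyvaginPrime (W.conductorNorm ℤ) W K p) ℓ :=
    KolyvaginDescent.kolSupp_prime hℓ hkol
  have hcard : ℓ.primeFactors.card = 1 := by
    rw [hℓ.primeFactors, Finset.card_singleton]
  obtain ⟨ht, hc, -, hc', hev⟩ :=
    shaCorank_eq_zero_of_kolyvaginClass_ne_zero_of_depth_lt_rank hF W p h5 hsurj K hK h3 h4 hpd hpN
      hH Dt β ι ℓ d M hΛ hM hMle hne (by omega)
  refine ⟨ht, by omega, ?_⟩
  rw [hr] at hc' hev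
  have h2 := Nat.even_iff.mp hev
  omega

/-! ## The crux versus its weak form -/

/-- **Modulo Kolyvagin 1991 Thm. 4 the crux `KolyvaginDepthSupply` is equivalent to its WEAK form**
(same objects; the minimality conjunct dropped and the rank clause relaxed to
`ν(n) + 1 ≤ rank E(ℚ) ∨ (ν(n) ≤ rank E(ℚ) ∧ ν(n) + 1 ≤ rank E^{(d_K)}(ℚ))`, written out literally
as a `Prop` — it is a reformulation offered to the planner, not a registered statement, and no
`def` is minted). `→`: a fortiori. `←`: the doors above pin the dichotomy at the minimal non-zero
class `c_{M₀}(n₀)` of the same system, which then satisfies the crux's exact clause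
(`ν(n₀) + 1 = rank E(ℚ) > rank E^{(d_K)}(ℚ)`, resp. `ν(n₀) = rank E(ℚ) = rank E^{(d_K)}(ℚ) − 1`)
together with minimality. Reading: the minimality conjunct and the equations of the crux are idle
for the kernel of `closes`; a depth table instantiates the weak form row by row. CONDITIONAL on
`hF`. [cite: Kolyvagin1991MathAnn, §2 Thm. 4] [cite: WZhang2014, Thm. 11.2 (i) (p. 248)]
[cite: GreenbergLNM1716, §1 pp. 54–57] -/
theorem kolyvaginDepthSupply_iff_weak
    (hF : Kolyvagin1991_selmerCorank_of_kolyvaginClass_ne_zero) :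
    KolyvaginDepthSupply ↔
      ∀ (W : WeierstrassCurve ℚ) [W.IsElliptic] [W.IsGloballyMinimal], ¬ W.HasCM →
        ∃ (p : ℕ) (hp : Fact p.Prime), 5 ≤ p ∧ W.HasGoodReductionAtPrime p ∧
          ¬ (p : ℤ) ∣ W.frobeniusTrace p ∧ W.HasSurjectiveModNGaloisRep p ∧
          ∃ (K : Type) (_ : Field K) (_ : NumberField K), IsImaginaryQuadratic K ∧
            NumberField.discr K ≠ -3 ∧ NumberField.discr K ≠ -4 ∧
            ¬ ((p : ℤ) ∣ NumberField.discr K) ∧ ¬ (p ∣ W.conductorNorm ℤ) ∧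
            ∃ (_ : NeZero (W.conductorNorm ℤ)),
              SatisfiesHeegnerHypothesis (W.conductorNorm ℤ) K ∧
              ∃ (Dt : ModularParametrizationData W (W.conductorNorm ℤ)) (β : ℤ) (ι : K →+* ℂ) (n : ℕ)
                (d : KolyvaginHeegnerData Dt β ι n) (M : ℕ),
                KolyvaginDescent.KolSupp (Zhang2014.IsKolyvaginPrime (W.conductorNorm ℤ) W K p) n ∧
                1 ≤ M ∧ (M : ℕ∞) ≤ Zhang2014.levelIndex W p n ∧ d.kolyvaginClass hp.out M ≠ 0 ∧
                (n.primeFactors.card + 1 ≤ W.mordellWeilRank ∨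
                  (n.primeFactors.card ≤ W.mordellWeilRank ∧
                    n.primeFactors.card + 1 ≤
                      (W.quadraticTwist (NumberField.discr K : ℚ)).mordellWeilRank)) := by
  constructor
  · intro hS W _ _ hcm
    obtain ⟨p, hp, h5, hgood, hord, hsurj, K, iF, iN, hIQ, h3, h4, hpd, hpN, iNZ, hH, Dt, β, ι, n, d,
      M, hsupp, hM1, hMle, hne, -, hrk⟩ := hS W hcm
    exact ⟨p, hp, h5, hgood, hord, hsurj, K, iF, iN, hIQ, h3, h4, hpd, hpN, iNZ, hH, Dt, β, ι, n, d,
      M, hsupp, hM1, hMle, hne, by omega⟩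
  · intro hS W _ _ hcm
    obtain ⟨p, hp, h5, hgood, hord, hsurj, K, iF, iN, hIQ, h3, h4, hpd, hpN, iNZ, hH, Dt, β, ι, n, d,
      M, hsupp, hM1, hMle, hne, hrk⟩ := hS W hcm
    refine ⟨p, hp, h5, hgood, hord, hsurj, K, iF, iN, hIQ, h3, h4, hpd, hpN, iNZ, hH, ?_⟩
    -- the minimal non-zero class of the same system and the dichotomy there
    obtain ⟨n₀, d₀, M₀, hΛ₀, hM₀, hM₀le, hne₀, hle, hmin, hstruct⟩ :=
      exists_minimal_kolyvaginClass_ne_zero hF W p h5 hsurj K hIQ h3 h4 hpd hpN hH Dt β ι n d M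
        hsupp hM1 hMle hne
    refine ⟨Dt, β, ι, n₀, d₀, M₀, hΛ₀, hM₀, hM₀le, hne₀, hmin, ?_⟩
    -- Kummer on `E` and on the twist
    have hid : W.selmerCorank p = W.mordellWeilRank + W.shaCorank p :=
      W.selmerCorank_eq_mordellWeilRank_add_holds p
    have hdK : (NumberField.discr K : ℚ) ≠ 0 := by exact_mod_cast NumberField.discr_ne_zero K
    haveI := W.isElliptic_quadraticTwist hdK
    have hidT : (W.quadraticTwist (NumberField.discr K : ℚ)).selmerCorank p =
        (W.quadraticTwist (NumberField.discr K : ℚ)).mordellWeilRank +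
          (W.quadraticTwist (NumberField.discr K : ℚ)).shaCorank p :=
      (W.quadraticTwist (NumberField.discr K : ℚ)).selmerCorank_eq_mordellWeilRank_add_holds p
    rcases hrk with hA | ⟨hB, hB'⟩
    · rcases hstruct with ⟨hc, hc', -⟩ | ⟨-, hc, -⟩
      · left
        omega
      · exfalso
        omega
    · rcases hstruct with ⟨-, hc', -⟩ | ⟨hc', hc, -⟩
      · exfalso
        omega
      · right
        omega

/-- **The kernel of `closes` from the weak form: weak depth supply + Kolyvagin 1991 Thm. 4 ⇒ X1 on
non-CM curves.** If every non-CM globally minimal `E/ℚ` carries, at some `p ≥ 5` good ordinary with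
`ρ̄_{E,p}` onto and some admissible Heegner field `K`, a non-zero Kolyvagin–Heegner class `c_M(n)`
with `ν(n) + 1 ≤ rank E(ℚ)` or (`ν(n) ≤ rank E(ℚ)` and `ν(n) + 1 ≤ rank E^{(d_K)}(ℚ)`), then every
non-CM globally minimal `E/ℚ` has a good ordinary `p ≥ 5` with `corank_{ℤ_p} Ш(E)[p^∞] = 0` — the
hypothesis `hX1` of the route's deciding theorem on the non-CM locus, obtained from LESS than the
crux asks. CONDITIONAL on `hF` and on the (open, class-wide X1-hard) weak supply; BSD is not proved
by it. [cite: Kolyvagin1991MathAnn, §2 Thm. 4] [cite: GreenbergLNM1716, §1 pp. 54–57] -/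
theorem shaCorank_eq_zero_nonCM_of_weakDepthSupply
    (hF : Kolyvagin1991_selmerCorank_of_kolyvaginClass_ne_zero)
    (hS : ∀ (W : WeierstrassCurve ℚ) [W.IsElliptic] [W.IsGloballyMinimal], ¬ W.HasCM →
        ∃ (p : ℕ) (hp : Fact p.Prime), 5 ≤ p ∧ W.HasGoodReductionAtPrime p ∧
          ¬ (p : ℤ) ∣ W.frobeniusTrace p ∧ W.HasSurjectiveModNGaloisRep p ∧
          ∃ (K : Type) (_ : Field K) (_ : NumberField K), IsImaginaryQuadratic K ∧
            NumberField.discr K ≠ -3 ∧ NumberField.discr K ≠ -4 ∧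
            ¬ ((p : ℤ) ∣ NumberField.discr K) ∧ ¬ (p ∣ W.conductorNorm ℤ) ∧
            ∃ (_ : NeZero (W.conductorNorm ℤ)),
              SatisfiesHeegnerHypothesis (W.conductorNorm ℤ) K ∧
              ∃ (Dt : ModularParametrizationData W (W.conductorNorm ℤ)) (β : ℤ) (ι : K →+* ℂ) (n : ℕ)
                (d : KolyvaginHeegnerData Dt β ι n) (M : ℕ),
                KolyvaginDescent.KolSupp (Zhang2014.IsKolyvaginPrime (W.conductorNorm ℤ) W K p) n ∧
                1 ≤ M ∧ (M : ℕ∞) ≤ Zhang2014.levelIndex W p n ∧ d.kolyvaginClass hp.out M ≠ 0 ∧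
                (n.primeFactors.card + 1 ≤ W.mordellWeilRank ∨
                  (n.primeFactors.card ≤ W.mordellWeilRank ∧
                    n.primeFactors.card + 1 ≤
                      (W.quadraticTwist (NumberField.discr K : ℚ)).mordellWeilRank))) :
    ∀ (W : WeierstrassCurve ℚ) [W.IsElliptic] [W.IsGloballyMinimal], ¬ W.HasCM →
      ∃ (p : ℕ) (_ : Fact p.Prime), 5 ≤ p ∧ W.HasGoodReductionAtPrime p ∧
        ¬ (p : ℤ) ∣ W.frobeniusTrace p ∧ W.shaCorank p = 0 := by
  intro W _ _ hcm
  obtain ⟨p, hp, h5, hgood, hord, hsurj, K, iF, iN, hIQ, h3, h4, hpd, hpN, iNZ, hH, Dt, β, ι, n, d,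
    M, hsupp, hM1, hMle, hne, hrk⟩ := hS W hcm
  refine ⟨p, hp, h5, hgood, hord, ?_⟩
  rcases hrk with hA | ⟨hB, hB'⟩
  · exact (shaCorank_eq_zero_of_kolyvaginClass_ne_zero_of_depth_lt_rank hF W p h5 hsurj K hIQ h3 h4
      hpd hpN hH Dt β ι n d M hsupp hM1 hMle hne hA).1
  · exact (shaCorank_eq_zero_of_kolyvaginClass_ne_zero_of_depth_lt_twist_rank hF W p h5 hsurj K hIQ
      h3 h4 hpd hpN hH Dt β ι n d M hsupp hM1 hMle hne hB hB').1

end Summit.BirchSwinnertonDyer.BirchSwinnertonDyer.Theorems.KolyvaginDepthDoor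

end
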